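import Literature.Analysis.FluidPDE.ElgindiSolutionCauchy
import Literature.Analysis.FluidPDE.ElgindiSolutionLimitsLoc
import Literature.Analysis.FluidPDE.ElgindiHkClosure
import Literature.Analysis.FluidPDE.ElgindiHkDensity
import Mathlib.MeasureTheory.Function.LpSpace.Complete
import HarnessLib

/-!
# Solvability of `L_α Ψ = F` for data in the `𝓗⁴`-closure of the test functions
([Elgindi2021] §7.5 Theorem 2, existence part, general data)

Topic `Literature/Analysis/FluidPDE`. Support file (definitions with bodies and proved theorems, no
named facts) on the proof path of the named fact
`Literature.Analysis.FluidPDE.Elgindi.ElgindiGhoulMasmoudi2021_stabilityCore`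
(`ElgindiStabilityDecomposition.lean`). T. M. Elgindi, Ann. of Math. 194 (2021) =
arXiv:1904.04795, §7.5 Theorem 2 (p. 24) with Remark 8.3 (density of `C_c^∞`).

For a datum `F` smooth on the open strip which is the `𝓗⁴`-limit of test functions `f_n`
(`HkApprox α F f`), the Theorem 2 solutions `Ψ_n = Ψ̂_n − G_n ⊗ sin 2θ` of `L_αΨ_n = f_n` are Cauchy in
the weighted space `L¹(strip, e^{−R}dRdθ)` (`ElgindiSolutionCauchy.lean`); along a fast subsequence
they converge a.e. and in `L¹_loc`, and the limit is (a.e. equal to) a smooth solution of `L_αΨ = F` on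
the strip (`ElgindiSolutionLimitsLoc.lean`). Main results: `exists_solution_closure` (with the
convergence of the approximating solutions, for the passage to the limit in the Theorem 2 bounds) and
`exists_solution_of_hkApprox`, `exists_solution_of_finite` (pure existence).
-/

noncomputable section

open MeasureTheory Set Function Real Filter Finset
open _root_.Topology
open scoped ENNReal ContDiff

namespace Literature.Analysis.FluidPDE

namespace Elgindi

/-! ### Tools -/

/-- A test function of the strip is a nice datum. [folklore] -/
theorem StripTest.niceDatum {f : ℝ → ℝ → ℝ} (hf : StripTest f) : NiceDatum f := ⟨hf.smooth, hf.supp, hf.sub⟩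

/-- `|f − g|²_{𝓗ᵏ} = |g − f|²_{𝓗ᵏ}`. [folklore] -/
theorem eHkNormSq_sub_comm (α : ℝ) (k : ℕ) (f g : ℝ → ℝ → ℝ) : eHkNormSq α k (f - g) = eHkNormSq α k (g - f) := by
  have e : f - g = (-1 : ℝ) • (g - f) := by funext z θ; simp
  rw [e, eHkNormSq_smul, Real.enorm_eq_ofReal_abs, abs_neg, abs_one, ENNReal.ofReal_one, one_pow, one_mul]

/-- `|f − g|²_{𝓗⁴} ≤ 2|f − h|²_{𝓗⁴} + 2|g − h|²_{𝓗⁴}` for `C⁴` functions of the strip. [folklore] -/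
theorem eHkNormSq_sub_le_two {α : ℝ} {f g h : ℝ → ℝ → ℝ} (hf : ContDiffOn ℝ 4 (uncurry f) strip)
    (hg : ContDiffOn ℝ 4 (uncurry g) strip) (hh : ContDiffOn ℝ 4 (uncurry h) strip) :
    eHkNormSq α 4 (f - g) ≤ 2 * eHkNormSq α 4 (f - h) + 2 * eHkNormSq α 4 (g - h) := by
  have e : f - g = (f - h) + (h - g) := by funext z θ; simp
  rw [e, eHkNormSq_sub_comm α 4 g h]
  exact eHkNormSq_add_le (hf.sub hh) (hh.sub hg)

/-- `ρ` is continuous. [folklore] -/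
theorem continuous_rhoW : Continuous rhoW := by unfold rhoW; fun_prop

/-- `ρ(p)·e^{p.1} = 1`. [folklore] -/
theorem rhoW_mul_exp (p : ℝ × ℝ) : rhoW p * Real.exp p.1 = 1 := by
  unfold rhoW; rw [← Real.exp_add]; simp

/-- On a compact set `e^{p.1}` is bounded. [folklore] -/
theorem exists_exp_le_of_isCompact {K : Set (ℝ × ℝ)} (hK : IsCompact K) : ∃ R : ℝ, ∀ p ∈ K, Real.exp p.1 ≤ Real.exp R := by
  obtain ⟨R, hR⟩ := hK.bddAbove_image continuous_fst.continuousOn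
  exact ⟨R, fun p hp => Real.exp_le_exp.2 (hR ⟨p, hp, rfl⟩)⟩

/-- **Cauchy–Schwarz on a set**: `∫_K |g| ≤ (∫_K g²)^{1/2}·(vol K)^{1/2}`. [folklore] -/
theorem lintegral_abs_le_sqrt {K : Set (ℝ × ℝ)} {g : ℝ × ℝ → ℝ} (hg : AEMeasurable g (volume.restrict K)) :
    ∫⁻ p in K, ENNReal.ofReal |g p| ≤ (∫⁻ p in K, ENNReal.ofReal (g p ^ 2)) ^ (1 / 2 : ℝ) * (volume K) ^ (1 / 2 : ℝ) := by
  set Fq : ℝ × ℝ → ℝ≥0∞ := fun p => ENNReal.ofReal |g p| with hF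
  have mF : AEMeasurable Fq (volume.restrict K) := (continuous_abs.measurable.comp_aemeasurable hg).ennreal_ofReal
  have hH := ENNReal.lintegral_mul_le_Lp_mul_Lq (volume.restrict K) Real.HolderConjugate.two_two mF
    (aemeasurable_const (b := (1:ℝ≥0∞)))
  have e2 : ∀ (x : ℝ), 0 ≤ x → ENNReal.ofReal x ^ (2:ℝ) = ENNReal.ofReal (x ^ 2) := fun x hx => by
    rw [show (2:ℝ) = ((2:ℕ) : ℝ) by norm_num, ENNReal.rpow_natCast, ENNReal.ofReal_pow hx]
  have eF2 : ∀ p : ℝ × ℝ, Fq p ^ (2:ℝ) = ENNReal.ofReal (g p ^ 2) := fun p => by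
    simp only [hF]; rw [e2 _ (abs_nonneg _), sq_abs]
  have eF1 : ∀ p : ℝ × ℝ, (Fq * fun (_ : ℝ × ℝ) => (1:ℝ≥0∞)) p = ENNReal.ofReal |g p| := fun p => by
    simp only [Pi.mul_apply, mul_one, hF]
  simp_rw [eF1, eF2, ENNReal.one_rpow, lintegral_const, one_mul] at hH
  rw [Measure.restrict_apply_univ] at hH
  exact hH

/-- Along an `𝓗⁴`-approximating sequence the data converge in `L¹(K)`, `K ⊆ strip` compact. [folklore] -/
theorem HkApprox.tendsto_setIntegral_sub {α : ℝ} {F : ℝ → ℝ → ℝ} {fs : ℕ → ℝ → ℝ → ℝ} (hA : HkApprox α F fs)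
    {K : Set (ℝ × ℝ)} (hK : IsCompact K) (hKs : K ⊆ strip) :
    Tendsto (fun n => ∫ p in K, |fs n p.1 p.2 - F p.1 p.2|) atTop (𝓝 0) := by
  have hKm : MeasurableSet K := hK.measurableSet
  have hvol : volume K ≠ ⊤ := hK.measure_lt_top.ne
  have hc : ∀ n, ContinuousOn (fun p : ℝ × ℝ => fs n p.1 p.2 - F p.1 p.2) strip := fun n =>
    ((hA.test n).smooth 0).continuous.continuousOn.sub hA.smooth.continuousOn
  have hm : ∀ n, AEStronglyMeasurable (fun p : ℝ × ℝ => fs n p.1 p.2 - F p.1 p.2) (volume.restrict K) := fun n =>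
    ((hc n).mono hKs).aestronglyMeasurable hKm
  have e : ∀ n, ∫ p in K, |fs n p.1 p.2 - F p.1 p.2| = (∫⁻ p in K, ENNReal.ofReal |fs n p.1 p.2 - F p.1 p.2|).toReal := by
    intro n
    rw [integral_eq_lintegral_of_nonneg_ae (ae_of_all _ fun p => abs_nonneg _) (hm n).norm]
  have h0 : Tendsto (fun n => ∫⁻ p in K, ENNReal.ofReal |fs n p.1 p.2 - F p.1 p.2|) atTop (𝓝 0) := by
    have hb : ∀ n, ∫⁻ p in K, ENNReal.ofReal |fs n p.1 p.2 - F p.1 p.2| ≤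
        (eHkNormSq α 4 (fs n - F)) ^ (1 / 2 : ℝ) * (volume K) ^ (1 / 2 : ℝ) := by
      intro n
      refine (lintegral_abs_le_sqrt (hm n).aemeasurable).trans ?_
      gcongr
      refine (lintegral_mono_set hKs).trans ?_
      exact lintegral_sq_le_eHkNormSq α (fs n - F)
    have hr : Tendsto (fun n => (eHkNormSq α 4 (fs n - F)) ^ (1 / 2 : ℝ) * (volume K) ^ (1 / 2 : ℝ)) atTop (𝓝 0) := by
      have h1 : Tendsto (fun n => (eHkNormSq α 4 (fs n - F)) ^ (1 / 2 : ℝ)) atTop (𝓝 0) := by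
        have := ((ENNReal.continuous_rpow_const (y := (1 / 2 : ℝ))).tendsto (0:ℝ≥0∞)).comp hA.conv
        rwa [ENNReal.zero_rpow_of_pos (by norm_num : (0:ℝ) < 1 / 2)] at this
      have := ENNReal.Tendsto.mul_const h1 (Or.inr (ENNReal.rpow_ne_top_of_nonneg (by norm_num : (0:ℝ) ≤ 1 / 2) hvol))
      rwa [zero_mul] at this
    exact tendsto_of_tendsto_of_tendsto_of_le_of_le tendsto_const_nhds hr (fun n => bot_le) hb
  rw [show (fun n => ∫ p in K, |fs n p.1 p.2 - F p.1 p.2|) =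
      fun n => (∫⁻ p in K, ENNReal.ofReal |fs n p.1 p.2 - F p.1 p.2|).toReal from funext e, ← ENNReal.toReal_zero]
  exact (ENNReal.tendsto_toReal ENNReal.zero_ne_top).comp h0

/-- A fast `𝓗⁴`-approximating subsequence: `|f_{n_k} − F|²_{𝓗⁴} ≤ 4^{−k}`. [folklore] -/
theorem HkApprox.exists_fast {α : ℝ} {F : ℝ → ℝ → ℝ} {fs : ℕ → ℝ → ℝ → ℝ} (hA : HkApprox α F fs) :
    ∃ ns : ℕ → ℕ, StrictMono ns ∧ ∀ n, eHkNormSq α 4 (fs (ns n) - F) ≤ ((2:ℝ≥0∞)⁻¹ ^ n) ^ 2 := by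
  refine extraction_forall_of_eventually (P := fun n k => eHkNormSq α 4 (fs k - F) ≤ ((2:ℝ≥0∞)⁻¹ ^ n) ^ 2) fun n => ?_
  have hpos : (0:ℝ≥0∞) < ((2:ℝ≥0∞)⁻¹ ^ n) ^ 2 :=
    pos_iff_ne_zero.2 (pow_ne_zero _ (pow_ne_zero _ (ENNReal.inv_ne_zero.2 ENNReal.ofNat_ne_top)))
  exact (hA.conv.eventually (gt_mem_nhds hpos)).mono fun k hk => hk.le

/-- A function `u` with `u·ρ ∈ L¹(strip)` is integrable on compact subsets of the strip. [folklore] -/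
theorem integrableOn_of_weighted {u : ℝ × ℝ → ℝ} (hu : AEStronglyMeasurable u (volume.restrict strip))
    (hi : Integrable (fun p => u p * rhoW p) (volume.restrict strip)) {K : Set (ℝ × ℝ)} (hK : IsCompact K) (hKs : K ⊆ strip) :
    IntegrableOn u K volume := by
  obtain ⟨R, hR⟩ := exists_exp_le_of_isCompact hK
  have hle : (volume.restrict K : Measure (ℝ × ℝ)) ≤ volume.restrict strip := Measure.restrict_mono hKs le_rfl
  have hg : Integrable (fun p => Real.exp R * |u p * rhoW p|) (volume.restrict K) := ((hi.mono_measure hle).abs.const_mul _)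
  refine Integrable.mono' hg (hu.mono_measure hle) ?_
  refine (ae_restrict_iff' hK.measurableSet).2 (ae_of_all _ fun p hp => ?_)
  rw [Real.norm_eq_abs]
  have h1 : |u p| = |u p * rhoW p| * Real.exp p.1 := by
    rw [abs_mul, abs_of_pos (rhoW_pos p), mul_assoc, rhoW_mul_exp, mul_one]
  calc |u p| = |u p * rhoW p| * Real.exp p.1 := h1
    _ ≤ |u p * rhoW p| * Real.exp R := mul_le_mul_of_nonneg_left (hR p hp) (abs_nonneg _)
    _ = Real.exp R * |u p * rhoW p| := mul_comm _ _

/-- … hence locally integrable on the strip. [folklore] -/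
theorem locallyIntegrableOn_of_weighted {u : ℝ × ℝ → ℝ} (hu : AEStronglyMeasurable u (volume.restrict strip))
    (hi : Integrable (fun p => u p * rhoW p) (volume.restrict strip)) : LocallyIntegrableOn u strip volume :=
  (locallyIntegrableOn_iff isOpen_strip.isLocallyClosed).2 fun _K hKs hK => integrableOn_of_weighted hu hi hK hKs

/-- Weighted-`L¹(strip)` convergence gives `L¹(K)` convergence on compact `K ⊆ strip`. [folklore] -/
theorem tendsto_setIntegral_abs_of_weighted {v : ℕ → ℝ × ℝ → ℝ} (hv : ∀ n, AEStronglyMeasurable (v n) (volume.restrict strip))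
    (ht : Tendsto (fun n => ∫⁻ p in strip, ENNReal.ofReal (|v n p| * rhoW p)) atTop (𝓝 0))
    {K : Set (ℝ × ℝ)} (hK : IsCompact K) (hKs : K ⊆ strip) :
    Tendsto (fun n => ∫ p in K, |v n p|) atTop (𝓝 0) := by
  have hKm : MeasurableSet K := hK.measurableSet
  obtain ⟨R, hR⟩ := exists_exp_le_of_isCompact hK
  have hm : ∀ n, AEStronglyMeasurable (v n) (volume.restrict K) := fun n =>
    (hv n).mono_measure (Measure.restrict_mono hKs le_rfl)
  have e : ∀ n, ∫ p in K, |v n p| = (∫⁻ p in K, ENNReal.ofReal |v n p|).toReal := fun n => by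
    rw [integral_eq_lintegral_of_nonneg_ae (ae_of_all _ fun p => abs_nonneg _) (hm n).norm]
  have hb : ∀ n, ∫⁻ p in K, ENNReal.ofReal |v n p| ≤ ENNReal.ofReal (Real.exp R) * ∫⁻ p in strip, ENNReal.ofReal (|v n p| * rhoW p) := by
    intro n
    calc ∫⁻ p in K, ENNReal.ofReal |v n p| ≤ ∫⁻ p in K, ENNReal.ofReal (Real.exp R) * ENNReal.ofReal (|v n p| * rhoW p) := by
          refine setLIntegral_mono' hKm fun p hp => ?_
          rw [← ENNReal.ofReal_mul (Real.exp_pos R).le]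
          refine ENNReal.ofReal_le_ofReal ?_
          have h1 : |v n p| = |v n p| * rhoW p * Real.exp p.1 := by rw [mul_assoc, rhoW_mul_exp, mul_one]
          have h0 : 0 ≤ |v n p| * rhoW p := mul_nonneg (abs_nonneg _) (rhoW_pos p).le
          calc |v n p| = |v n p| * rhoW p * Real.exp p.1 := h1
            _ ≤ |v n p| * rhoW p * Real.exp R := mul_le_mul_of_nonneg_left (hR p hp) h0
            _ = Real.exp R * (|v n p| * rhoW p) := by ring
      _ = ENNReal.ofReal (Real.exp R) * ∫⁻ p in K, ENNReal.ofReal (|v n p| * rhoW p) := by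
          rw [lintegral_const_mul' _ _ ENNReal.ofReal_ne_top]
      _ ≤ ENNReal.ofReal (Real.exp R) * ∫⁻ p in strip, ENNReal.ofReal (|v n p| * rhoW p) :=
          mul_le_mul_right (lintegral_mono_set hKs) _
  have hup : Tendsto (fun n => ENNReal.ofReal (Real.exp R) * ∫⁻ p in strip, ENNReal.ofReal (|v n p| * rhoW p)) atTop (𝓝 0) := by
    have := ENNReal.Tendsto.const_mul ht (Or.inr (ENNReal.ofReal_ne_top (r := Real.exp R)))
    rwa [mul_zero] at this
  have h0 : Tendsto (fun n => ∫⁻ p in K, ENNReal.ofReal |v n p|) atTop (𝓝 0) :=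
    tendsto_of_tendsto_of_tendsto_of_le_of_le tendsto_const_nhds hup (fun n => bot_le) hb
  rw [show (fun n => ∫ p in K, |v n p|) = fun n => (∫⁻ p in K, ENNReal.ofReal |v n p|).toReal from funext e,
    ← ENNReal.toReal_zero]
  exact (ENNReal.tendsto_toReal ENNReal.zero_ne_top).comp h0

/-! ### The limit solution along a fast approximating sequence -/

section approx

variable {α : ℝ} {F : ℝ → ℝ → ℝ} {fs : ℕ → ℝ → ℝ → ℝ} (hA : HkApprox α F fs)
  {U : ℕ → ℕ → E4} {Ψr : ℕ → ℝ × ℝ → ℝ} (hS : ∀ n, SolData α (Fhat (fs n)) (U n) (Ψr n))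
include hA hS

/-- **The Theorem 2 solutions along a fast approximating sequence converge**: if
`|f_n − F|²_{𝓗⁴} ≤ 4^{−n}`, the solutions `Ψ_n = Ψ_{f_n}` converge a.e. on the strip and in `L¹(ρ)` to a
function `u` with `uρ ∈ L¹(strip)` (completeness of `L¹`, [folklore]; the Cauchy property is
`lintegral_thmTwoSol_sub_le`). -/
theorem exists_limit_of_fast (hfast : ∀ n, eHkNormSq α 4 (fs n - F) ≤ ((2:ℝ≥0∞)⁻¹ ^ n) ^ 2) :
    ∃ u : ℝ × ℝ → ℝ, AEStronglyMeasurable u (volume.restrict strip) ∧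
      Integrable (fun p => u p * rhoW p) (volume.restrict strip) ∧
      (∀ᵐ p ∂(volume.restrict strip), Tendsto (fun n => thmTwoSol α (fs n) (Ψr n) p.1 p.2) atTop (𝓝 (u p))) ∧
      Tendsto (fun n => ∫⁻ p in strip, ENNReal.ofReal (|thmTwoSol α (fs n) (Ψr n) p.1 p.2 - u p| * rhoW p)) atTop (𝓝 0) := by
  have hα : 0 < α := (hS 0).pos
  have hα4 : α ≤ 1 / 4 := (hS 0).le4
  have hN : ∀ n, NiceDatum (fs n) := fun n => (hA.test n).niceDatum
  have hT := fun n => theoremTwo_solData hα hα4 (hN n) (hS n)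
  -- the weighted solutions
  set g : ℕ → ℝ × ℝ → ℝ := fun n p => thmTwoSol α (fs n) (Ψr n) p.1 p.2 * rhoW p with hg
  have hcont : ∀ n, ContinuousOn (fun p : ℝ × ℝ => thmTwoSol α (fs n) (Ψr n) p.1 p.2) strip := fun n => (hT n).1.continuousOn
  have hmeas : ∀ n, AEStronglyMeasurable (g n) (volume.restrict strip) := fun n =>
    ((hcont n).mul continuous_rhoW.continuousOn).aestronglyMeasurable measurableSet_strip
  -- the Cauchy bound
  set B : ℕ → ℝ≥0∞ := fun N => (cauchyC α + 1) * (2 * (2:ℝ≥0∞)⁻¹ ^ N) with hB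
  have hr1 : ∀ {N n : ℕ}, N ≤ n → (2:ℝ≥0∞)⁻¹ ^ n ≤ (2:ℝ≥0∞)⁻¹ ^ N := fun h =>
    pow_le_pow_right_of_le_one' (ENNReal.inv_le_one.2 one_le_two) h
  have hBsum : ∑' i, B i ≠ ⊤ := by
    simp only [hB]
    rw [ENNReal.tsum_mul_left, ENNReal.tsum_mul_left, ENNReal.tsum_geometric, ENNReal.one_sub_inv_two, inv_inv]
    exact ENNReal.mul_ne_top (ENNReal.add_ne_top.2 ⟨cauchyC_ne_top α, ENNReal.one_ne_top⟩)
      (ENNReal.mul_ne_top ENNReal.ofNat_ne_top ENNReal.ofNat_ne_top)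
  have hF4 : ContDiffOn ℝ 4 (uncurry F) strip :=
    hA.smooth.of_le (WithTop.coe_le_coe.2 le_top : (4 : WithTop ℕ∞) ≤ ((⊤ : ℕ∞) : WithTop ℕ∞))
  have hcau : ∀ N n m : ℕ, N ≤ n → N ≤ m → eLpNorm (g n - g m) 1 (volume.restrict strip) < B N := by
    intro N n m hn hm
    have e1 : eLpNorm (g n - g m) 1 (volume.restrict strip) =
        ∫⁻ p in strip, ENNReal.ofReal (|thmTwoSol α (fs n) (Ψr n) p.1 p.2 - thmTwoSol α (fs m) (Ψr m) p.1 p.2| * rhoW p) := by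
      rw [eLpNorm_one_eq_lintegral_enorm]
      refine lintegral_congr fun p => ?_
      rw [Pi.sub_apply, Real.enorm_eq_ofReal_abs]
      simp only [hg]
      rw [← sub_mul, abs_mul, abs_of_pos (rhoW_pos p)]
    rw [e1]
    refine (lintegral_thmTwoSol_sub_le (hN n) (hN m) (hS n) (hS m)).trans_lt ?_
    have hE : eHkNormSq α 4 (fs n - fs m) ≤ (2 * (2:ℝ≥0∞)⁻¹ ^ N) ^ 2 := by
      refine (eHkNormSq_sub_le_two ((hN n).smooth 4).contDiffOn ((hN m).smooth 4).contDiffOn hF4).trans ?_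
      calc 2 * eHkNormSq α 4 (fs n - F) + 2 * eHkNormSq α 4 (fs m - F)
          ≤ 2 * ((2:ℝ≥0∞)⁻¹ ^ n) ^ 2 + 2 * ((2:ℝ≥0∞)⁻¹ ^ m) ^ 2 := by
            gcongr
            · exact hfast n
            · exact hfast m
        _ ≤ 2 * ((2:ℝ≥0∞)⁻¹ ^ N) ^ 2 + 2 * ((2:ℝ≥0∞)⁻¹ ^ N) ^ 2 := by
            gcongr 2 * ?_ ^ 2 + 2 * ?_ ^ 2
            · exact hr1 hn
            · exact hr1 hm
        _ = (2 * (2:ℝ≥0∞)⁻¹ ^ N) ^ 2 := by ring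
    have hroot : (eHkNormSq α 4 (fs n - fs m)) ^ (1 / 2 : ℝ) ≤ 2 * (2:ℝ≥0∞)⁻¹ ^ N := by
      refine (ENNReal.rpow_le_rpow hE (by norm_num)).trans_eq ?_
      rw [← ENNReal.rpow_natCast (2 * (2:ℝ≥0∞)⁻¹ ^ N) 2, ← ENNReal.rpow_mul]; norm_num
    calc cauchyC α * (eHkNormSq α 4 (fs n - fs m)) ^ (1 / 2 : ℝ) ≤ cauchyC α * (2 * (2:ℝ≥0∞)⁻¹ ^ N) :=
          mul_le_mul_right hroot _
      _ < (cauchyC α + 1) * (2 * (2:ℝ≥0∞)⁻¹ ^ N) := by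
          refine ENNReal.mul_lt_mul_left ?_ ?_ (ENNReal.lt_add_right (cauchyC_ne_top α) one_ne_zero)
          · exact mul_ne_zero two_ne_zero (pow_ne_zero _ (ENNReal.inv_ne_zero.2 ENNReal.ofNat_ne_top))
          · exact ENNReal.mul_ne_top ENNReal.ofNat_ne_top (ENNReal.pow_ne_top (ENNReal.inv_ne_top.2 two_ne_zero))
  -- the a.e. limit of the weighted solutions
  have hae : ∀ᵐ p ∂(volume.restrict strip), ∃ l : ℝ, Tendsto (fun n => g n p) atTop (𝓝 l) :=
    Lp.ae_tendsto_of_cauchy_eLpNorm hmeas le_rfl hBsum hcau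
  set gl : ℝ × ℝ → ℝ := fun p => limUnder atTop (fun n => g n p) with hgl
  have hlim : ∀ᵐ p ∂(volume.restrict strip), Tendsto (fun n => g n p) atTop (𝓝 (gl p)) :=
    hae.mono fun p hp => tendsto_nhds_limUnder hp
  have hL1 : Tendsto (fun n => eLpNorm (g n - gl) 1 (volume.restrict strip)) atTop (𝓝 0) :=
    Lp.cauchy_tendsto_of_tendsto hmeas gl hBsum hcau hlim
  have hglm : AEStronglyMeasurable gl (volume.restrict strip) := aestronglyMeasurable_of_tendsto_ae atTop hmeas hlim
  have hgmem : ∀ n, MemLp (g n) 1 (volume.restrict strip) := by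
    intro n
    refine ⟨hmeas n, ?_⟩
    rw [eLpNorm_one_eq_lintegral_enorm]
    have e1 : ∫⁻ p, ‖g n p‖ₑ ∂(volume.restrict strip) = ∫⁻ p in strip, ENNReal.ofReal (|thmTwoSol α (fs n) (Ψr n) p.1 p.2| * rhoW p) := by
      refine lintegral_congr fun p => ?_
      rw [Real.enorm_eq_ofReal_abs]; simp only [hg]; rw [abs_mul, abs_of_pos (rhoW_pos p)]
    rw [e1]
    refine (lintegral_thmTwoSol_rho_le (hN n) (hS n)).trans_lt ?_
    exact ENNReal.mul_lt_top (cauchyC_ne_top α).lt_top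
      (ENNReal.rpow_lt_top_of_nonneg (by norm_num) (hA.test n).eHkNormSq_lt_top.ne)
  have hglmem : MemLp gl 1 (volume.restrict strip) := Lp.memLp_of_cauchy_tendsto le_rfl hgmem gl hglm hL1
  -- the limit `u = gl / ρ = gl · e^{R}`
  refine ⟨fun p => gl p * Real.exp p.1,
    hglm.mul (by fun_prop : Continuous fun p : ℝ × ℝ => Real.exp p.1).aestronglyMeasurable, ?_, ?_, ?_⟩
  · have e : (fun p : ℝ × ℝ => gl p * Real.exp p.1 * rhoW p) = gl := by
      funext p; rw [mul_assoc, mul_comm (Real.exp p.1), rhoW_mul_exp, mul_one]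
    rw [e]; exact memLp_one_iff_integrable.1 hglmem
  · filter_upwards [hlim] with p hp
    have e : ∀ n, thmTwoSol α (fs n) (Ψr n) p.1 p.2 = g n p * Real.exp p.1 := fun n => by
      simp only [hg]; rw [mul_assoc, rhoW_mul_exp, mul_one]
    simp_rw [e]
    exact hp.mul_const _
  · have e : ∀ n, ∫⁻ p in strip, ENNReal.ofReal (|thmTwoSol α (fs n) (Ψr n) p.1 p.2 - gl p * Real.exp p.1| * rhoW p) =
        eLpNorm (g n - gl) 1 (volume.restrict strip) := by
      intro n
      rw [eLpNorm_one_eq_lintegral_enorm]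
      refine lintegral_congr fun p => ?_
      rw [Pi.sub_apply, Real.enorm_eq_ofReal_abs]
      simp only [hg]
      have hid : thmTwoSol α (fs n) (Ψr n) p.1 p.2 * rhoW p - gl p =
          (thmTwoSol α (fs n) (Ψr n) p.1 p.2 - gl p * Real.exp p.1) * rhoW p := by
        have h1 := rhoW_mul_exp p
        rw [sub_mul, mul_assoc, mul_comm (Real.exp p.1), h1, mul_one]
      rw [hid, abs_mul, abs_of_pos (rhoW_pos p)]
    simp_rw [e]; exact hL1

/-- **Solvability along a fast approximating sequence**: the a.e./`L¹(ρ)` limit of the Theorem 2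
solutions is (a.e.) a smooth solution of `L_αΨ = F` on the strip. [cite: Elgindi2021, §7.5 Theorem 2 with Remark 8.3 (pp. 24, 27 of arXiv:1904.04795)] -/
theorem exists_solution_of_fast (hfast : ∀ n, eHkNormSq α 4 (fs n - F) ≤ ((2:ℝ≥0∞)⁻¹ ^ n) ^ 2) :
    ∃ Ψ : ℝ × ℝ → ℝ, ContDiffOn ℝ ∞ Ψ strip ∧ (∀ p ∈ strip, ellipticOp α (fun R θ => Ψ (R, θ)) p.1 p.2 = F p.1 p.2) ∧
      (∀ᵐ p ∂(volume.restrict strip), Tendsto (fun n => thmTwoSol α (fs n) (Ψr n) p.1 p.2) atTop (𝓝 (Ψ p))) ∧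
      Tendsto (fun n => ∫⁻ p in strip, ENNReal.ofReal (|thmTwoSol α (fs n) (Ψr n) p.1 p.2 - Ψ p| * rhoW p)) atTop (𝓝 0) := by
  have hα : 0 < α := (hS 0).pos
  have hα4 : α ≤ 1 / 4 := (hS 0).le4
  have hN : ∀ n, NiceDatum (fs n) := fun n => (hA.test n).niceDatum
  have hT := fun n => theoremTwo_solData hα hα4 (hN n) (hS n)
  obtain ⟨u, hum, hui, hae, hL1⟩ := exists_limit_of_fast hA hS hfast
  have hu : LocallyIntegrableOn u strip volume := locallyIntegrableOn_of_weighted hum hui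
  have hcont : ∀ n, ContinuousOn (fun p : ℝ × ℝ => thmTwoSol α (fs n) (Ψr n) p.1 p.2) strip := fun n => (hT n).1.continuousOn
  have hv : ∀ n, AEStronglyMeasurable (fun p : ℝ × ℝ => thmTwoSol α (fs n) (Ψr n) p.1 p.2 - u p) (volume.restrict strip) :=
    fun n => ((hcont n).aestronglyMeasurable measurableSet_strip).sub hum
  have hcu : ∀ K ⊆ strip, IsCompact K →
      Tendsto (fun n => ∫ p in K, |thmTwoSol α (fs n) (Ψr n) p.1 p.2 - u p|) atTop (𝓝 0) :=
    fun K hKs hK => tendsto_setIntegral_abs_of_weighted hv hL1 hK hKs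
  have hcf : ∀ K ⊆ strip, IsCompact K → Tendsto (fun n => ∫ p in K, |fs n p.1 p.2 - F p.1 p.2|) atTop (𝓝 0) :=
    fun K hKs hK => hA.tendsto_setIntegral_sub hK hKs
  have hFs : ∀ n, ContDiffOn ℝ ∞ (uncurry (fs n)) strip := fun n => (contDiff_infty.2 (hN n).smooth).contDiffOn
  obtain ⟨Ψ, hΨs, hΨae, hΨeq⟩ := exists_smooth_limit_solution_loc hα (Ψs := fun n p => thmTwoSol α (fs n) (Ψr n) p.1 p.2)
    (Fs := fun n p => fs n p.1 p.2) (fun n => (hT n).1) hFs (fun n p hp => (hT n).2.1 p hp) hu (F := uncurry F) hA.smooth hcu hcf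
  have hae' : ∀ᵐ p ∂(volume.restrict strip), u p = Ψ p := (ae_restrict_iff' measurableSet_strip).2 hΨae
  refine ⟨Ψ, hΨs, fun p hp => hΨeq p hp, ?_, ?_⟩
  · filter_upwards [hae, hae'] with p h1 h2
    rwa [← h2]
  · refine (tendsto_congr fun n => ?_).1 hL1
    refine lintegral_congr_ae ?_
    filter_upwards [hae'] with p hp
    rw [hp]

end approx

/-- **Solvability of `L_αΨ = F` in the closure class, with convergence of the approximating
solutions**: for `F` in the `𝓗⁴`-closure of the test functions (`HkApprox α F f`) and any solution
data of the modified problems `LΨ̂_n = F̂_n`, along a subsequence the Theorem 2 solutions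
`Ψ_n = Ψ̂_n − G_n ⊗ sin 2θ` converge a.e. on the strip and in `L¹(e^{−R}dRdθ)` to a smooth solution
`Ψ` of `L_αΨ = F` on the strip. [cite: Elgindi2021, §7.5 Theorem 2 with Remark 8.3 (pp. 24, 27 of arXiv:1904.04795)] -/
theorem exists_solution_closure {α : ℝ} {F : ℝ → ℝ → ℝ} {fs : ℕ → ℝ → ℝ → ℝ} (hA : HkApprox α F fs)
    {U : ℕ → ℕ → E4} {Ψr : ℕ → ℝ × ℝ → ℝ} (hS : ∀ n, SolData α (Fhat (fs n)) (U n) (Ψr n)) :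
    ∃ ns : ℕ → ℕ, StrictMono ns ∧ ∃ Ψ : ℝ × ℝ → ℝ, ContDiffOn ℝ ∞ Ψ strip ∧
      (∀ p ∈ strip, ellipticOp α (fun R θ => Ψ (R, θ)) p.1 p.2 = F p.1 p.2) ∧
      (∀ᵐ p ∂(volume.restrict strip), Tendsto (fun n => thmTwoSol α (fs (ns n)) (Ψr (ns n)) p.1 p.2) atTop (𝓝 (Ψ p))) ∧
      Tendsto (fun n => ∫⁻ p in strip, ENNReal.ofReal (|thmTwoSol α (fs (ns n)) (Ψr (ns n)) p.1 p.2 - Ψ p| * rhoW p))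
        atTop (𝓝 0) := by
  obtain ⟨ns, hns, hfast⟩ := hA.exists_fast
  exact ⟨ns, hns, exists_solution_of_fast (hA.subseq hns) (fun n => hS (ns n)) hfast⟩

/-- **Existence for closure data**: for `0 < α ≤ 1/4` and `F` in the `𝓗⁴`-closure of the test
functions there is a smooth solution of `L_αΨ = F` on the strip. [cite: Elgindi2021, §7.5 Theorem 2 with Remark 8.3 (pp. 24, 27 of arXiv:1904.04795)] -/
theorem exists_solution_of_hkApprox {α : ℝ} (hα : 0 < α) (hα4 : α ≤ 1 / 4) {F : ℝ → ℝ → ℝ} {fs : ℕ → ℝ → ℝ → ℝ}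
    (hA : HkApprox α F fs) :
    ∃ Ψ : ℝ × ℝ → ℝ, ContDiffOn ℝ ∞ Ψ strip ∧ ∀ p ∈ strip, ellipticOp α (fun R θ => Ψ (R, θ)) p.1 p.2 = F p.1 p.2 := by
  have hN : ∀ n, NiceDatum (fs n) := fun n => (hA.test n).niceDatum
  choose U Ψr hS using fun n => exists_solData hα hα4 (hN n).contDiff_Fhat (hN n).hasCompactSupport_Fhat.1
    (hN n).hasCompactSupport_Fhat.2 (fun m hm _ => (hN n).Fhat_orth hm)
  obtain ⟨ns, -, Ψ, hΨs, hΨeq, -, -⟩ := exists_solution_closure hA hS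
  exact ⟨Ψ, hΨs, hΨeq⟩

/-- **Existence for strip-smooth data of finite `𝓗⁴` functional and finite `γ`-words**
(`hkApprox_cutFun`: such data are in the closure class). [cite: Elgindi2021, §7.5 Theorem 2 with Remark 8.3 (pp. 24, 27 of arXiv:1904.04795)] -/
theorem exists_solution_of_finite {α : ℝ} (hα : 0 < α) (hα4 : α ≤ 1 / 4) {F : ℝ → ℝ → ℝ}
    (hF : ContDiffOn ℝ ∞ (uncurry F) strip) (hE : eHkNormSq α 4 F < ⊤) (hH : gammaWords α F < ⊤) :
    ∃ Ψ : ℝ × ℝ → ℝ, ContDiffOn ℝ ∞ Ψ strip ∧ ∀ p ∈ strip, ellipticOp α (fun R θ => Ψ (R, θ)) p.1 p.2 = F p.1 p.2 :=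
  exists_solution_of_hkApprox hα hα4 (hkApprox_cutFun α hF hE hH)

end Elgindi

end Literature.Analysis.FluidPDE
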